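import Summits.CriticalPhenomena.PercolationContinuityZ3.Theorems.PercNearOneGluingAdditiveGluingBlockGoodPeel
import Summits.CriticalPhenomena.PercolationContinuityZ3.Theorems.PercNearOneGluingAdditiveGluingBlockGoodCardFourReduction
import Literature.Probability.Percolation.BlockExplorationBasic
import HarnessLib

/-! # Crux `PercNearOneGluing.AdditiveGluing` (stmt-CriticalPhenomena-4576), kernel `residualKernel` — the DELETION-MINIMISER leaf
# (`blockGood_leaf_delMin`: Kozma–Nitzan's Theorem 4 at the glued block)

Invested seat `xfam-b` (cross-family direct attempt B on `residualKernel_two`); lands `--supports stmt-CriticalPhenomena-4576`; no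
definitions, no named facts.  `BG(u, A, S, b, a₀, sel)` is the block-goodness inequality of the un-glued graph (the conclusion of the
residual kernel `hres` of `goodStep_of_residualKernel`, = `hker` of `goodStep24_main` after `blockGrowth_glue_real_*`):
`μ(a₀↔b) + μ(a₀↮b, a₀↔S, S↔b) ≤ μ(S↔b) + Σ_{W∩A=∅} μ(K_S = W)·μ(sel W ↔ b in Wᶜ)`.

Method of this seat: decompose BG over the open STAR of the whole block (in the glued graph `u/S`, reveal the neighbours of the glued
vertex `s*`).  On the fibre where the block's outside neighbours are `B ≠ ∅` the two sides are `μ_{R/B}(B ↔ b)` and `μ_{R/B}(a₀ ↔ b)` for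
the DELETED graph `R = u − S` (every pair meeting `S` killed), so Kozma–Nitzan's Lemma 5 compares them as soon as `a₀` is below SOME
member of `B` in `R`; the fibre `B = ∅` is the pocket `K_S = S`, paid by the selection as soon as `a₀` minimises `μ_R(· ↔ b)` over `A`.
Hence the third leaf of the peeling certificate, next to `blockGood_leaf_lemma5` (H6: a block vertex at least as reliable as `a₀` in `u`)
and `blockGood_leaf_ih` (H7: `a₀` minimal in the GLUED graph `u/S`):

**`blockGood_leaf_delMin`.**  If `S ∩ A = ∅`, `a₀` minimises `μ_R(· ↔ b)` over `A` in the deleted graph `R = u − S`, and every vertex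
`z ∉ S` joined to `S` by a positive-weight pair satisfies `μ_R(a₀ ↔ b) ≤ μ_R(z ↔ b)`, then `BG(u, A, S, b, a₀, sel)` for every selection
`sel W ∈ A`.  (For the first open instance of `residualKernel_two` — `n = 6`, `V = A ∪ S` — the neighbour condition is implied by the
first, so the kernel holds there whenever the pre-gluing minimiser `a₀` is still a minimiser after DELETING the bad block; the open part
of that instance is the "deletion drift" `argmin_A μ_{u−S} ≠ a₀`.)
Proof: peel the block vertices one at a time with the exact σ-peel `blockGood_peel` (H5); all peels kill pairs at block vertices only,
so every intermediate deleted graph is `R`; the children are blocks `(rest of S) ∪ T` with `T` a set of positive-weight outside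
neighbours; when `S` is exhausted the block `T` is empty (the pocket inequality `μ_R(a₀↔b) ≤ μ_R(sel ∅ ↔ b)`), contains `b`
(trivial, the landed `blockGood_of_target_mem_block`), or contains an `R`-reliable vertex (H6 in `R`).
[cite: KozmaNitzan2024, §3.2 (Thm 4 p. 12, Lemma 5 p. 13, proof of Thm 5 p. 14)]
-/

namespace Summit.CriticalPhenomena.PercolationContinuityZ3.Theorems

open MeasureTheory Set
open Literature.Probability.LatticeModels (prodBernoulli)
open Literature.Probability.Percolation (BondConfig openConn openConnIn openGraph openCluster)
open scoped BigOperators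

noncomputable section
open Classical

section BlockGoodDelMin

open Literature.Probability.LatticeModels Literature.Probability.Percolation

variable {n : ℕ}

/-- `BG` for the EMPTY block is the pocket inequality `μ(a₀ ↔ b) ≤ μ(sel ∅ ↔ b)`. [folklore] -/
theorem blockGood_empty (u : Sym2 (Fin n) → unitInterval) (A : Finset (Fin n)) (b a₀ : Fin n)
    (sel : Finset (Fin n) → Fin n)
    (hle : (prodBernoulli u).real (openConn a₀ b) ≤ (prodBernoulli u).real (openConn (sel ∅) b)) :
    (prodBernoulli u).real (openConn a₀ b)
        + (prodBernoulli u).real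
            ((openConn a₀ b)ᶜ ∩ (⋃ s ∈ (∅ : Finset (Fin n)), openConn a₀ s) ∩ (⋃ s ∈ (∅ : Finset (Fin n)), openConn s b))
      ≤ (prodBernoulli u).real (⋃ s ∈ (∅ : Finset (Fin n)), openConn s b)
        + ∑ W ∈ (Finset.univ : Finset (Finset (Fin n))).filter (fun W => Disjoint W A),
            (prodBernoulli u).real {ω : BondConfig (Fin n) | ∀ z : Fin n, (z ∈ W ↔ ω ∈ ⋃ s ∈ (∅ : Finset (Fin n)), openConn s z)}
              * (prodBernoulli u).real (openConnIn ((W : Set (Fin n))ᶜ) (sel W) b) := by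
  have e1 : ∀ c : Fin n, (⋃ s ∈ (∅ : Finset (Fin n)), openConn c s : Set (BondConfig (Fin n))) = ∅ := fun c => by simp
  have e2 : ∀ z : Fin n, (⋃ s ∈ (∅ : Finset (Fin n)), openConn s z : Set (BondConfig (Fin n))) = ∅ := fun z => by simp
  have hpock : {ω : BondConfig (Fin n) | ∀ z : Fin n, (z ∈ (∅ : Finset (Fin n)) ↔ ω ∈ ⋃ s ∈ (∅ : Finset (Fin n)), openConn s z)}
      = Set.univ := by
    refine Set.eq_univ_of_forall fun ω z => ?_
    simp
  have huniv : (openConnIn (((∅ : Finset (Fin n)) : Set (Fin n))ᶜ) (sel ∅) b : Set (BondConfig (Fin n))) = openConn (sel ∅) b := by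
    ext ω
    rw [Finset.coe_empty, Set.compl_empty, BlockExploration.mem_openConn_iff_openConnIn_univ]
  have hmem : (∅ : Finset (Fin n)) ∈ (Finset.univ : Finset (Finset (Fin n))).filter (fun W => Disjoint W A) := by simp
  have hterm : (prodBernoulli u).real (openConn (sel ∅) b) ≤
      ∑ W ∈ (Finset.univ : Finset (Finset (Fin n))).filter (fun W => Disjoint W A),
        (prodBernoulli u).real {ω : BondConfig (Fin n) | ∀ z : Fin n, (z ∈ W ↔ ω ∈ ⋃ s ∈ (∅ : Finset (Fin n)), openConn s z)}
          * (prodBernoulli u).real (openConnIn ((W : Set (Fin n))ᶜ) (sel W) b) := by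
    refine le_trans ?_ (Finset.single_le_sum (fun W _ => mul_nonneg measureReal_nonneg measureReal_nonneg) hmem)
    rw [hpock, probReal_univ, one_mul, huniv]
  rw [e1 a₀, e2 b, Set.inter_empty, measureReal_empty, add_zero, zero_add]
  exact hle.trans hterm

/-- The peeling induction behind `blockGood_leaf_delMin`: `S` = block vertices still to peel (outside `A`, all their outside
neighbours `R`-reliable), `T` = already attached `R`-reliable outside vertices, `R = u − S` the deleted graph in which `a₀` is a
minimiser over `A`; then `BG(u, A, S ∪ T, b, a₀, sel)`. [cite: KozmaNitzan2024, §3.2 (Lemma 5 p. 13, proof of Thm 5 p. 14)] -/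
theorem blockGood_delMin_aux (k : ℕ) :
    ∀ (u R : Sym2 (Fin n) → unitInterval) (A S T : Finset (Fin n)) (b a₀ : Fin n) (sel : Finset (Fin n) → Fin n),
      S.card = k → b ∈ A → a₀ ∈ A → Disjoint S A → Disjoint S T → (∀ W, sel W ∈ A) →
      (∀ e, R e = if ∃ y ∈ S, y ∈ e then 0 else u e) →
      (∀ a ∈ A, (prodBernoulli R).real (openConn a₀ b) ≤ (prodBernoulli R).real (openConn a b)) →
      (∀ z ∈ T, (prodBernoulli R).real (openConn a₀ b) ≤ (prodBernoulli R).real (openConn z b)) →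
      (∀ s ∈ S, ∀ z : Fin n, z ∉ S → (u s(s, z) : ℝ) ≠ 0 →
        (prodBernoulli R).real (openConn a₀ b) ≤ (prodBernoulli R).real (openConn z b)) →
      (prodBernoulli u).real (openConn a₀ b)
        + (prodBernoulli u).real
            ((openConn a₀ b)ᶜ ∩ (⋃ s ∈ (S ∪ T), openConn a₀ s) ∩ (⋃ s ∈ (S ∪ T), openConn s b))
      ≤ (prodBernoulli u).real (⋃ s ∈ (S ∪ T), openConn s b)
        + ∑ W ∈ (Finset.univ : Finset (Finset (Fin n))).filter (fun W => Disjoint W A),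
            (prodBernoulli u).real {ω : BondConfig (Fin n) | ∀ z : Fin n, (z ∈ W ↔ ω ∈ ⋃ s ∈ (S ∪ T), openConn s z)}
              * (prodBernoulli u).real (openConnIn ((W : Set (Fin n))ᶜ) (sel W) b) := by
  induction k with
  | zero =>
    intro u R A S T b a₀ sel hcard hb ha₀ hSA hST hsel hR hmin hT hnbr
    obtain rfl : S = ∅ := Finset.card_eq_zero.1 hcard
    have hRu : R = u := funext fun e => by rw [hR e, if_neg (by simp)]
    subst hRu
    rw [Finset.empty_union]
    by_cases hT0 : T = ∅
    · subst hT0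
      exact blockGood_empty R A b a₀ sel (hmin _ (hsel ∅))
    by_cases hbT : b ∈ T
    · exact blockGood_of_target_mem_block R A T b a₀ sel hbT
    obtain ⟨v, hv⟩ := Finset.nonempty_iff_ne_empty.2 hT0
    exact blockGood_leaf_lemma5 R A T b a₀ v sel hv hbT (hT v hv)
  | succ k ih =>
    intro u R A S T b a₀ sel hcard hb ha₀ hSA hST hsel hR hmin hT hnbr
    obtain ⟨x, hx⟩ := Finset.card_pos.1 (by rw [hcard]; exact Nat.succ_pos k)
    have hxA : x ∉ A := Finset.disjoint_left.1 hSA hx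
    have hxT : x ∉ T := Finset.disjoint_left.1 hST hx
    refine blockGood_peel u A (S ∪ T) b a₀ x sel (Finset.mem_union_left T hx) hxA hb ha₀ hsel ?_
    intro S' hS'
    -- the layer does not contain `x`, and every vertex of it is a positive-weight neighbour of `x`
    have hxS' : x ∉ S' := fun h => hS' (by rw [peel_layer_eq_empty S' x h, measureReal_empty])
    have hS'w : ∀ z ∈ S', (u s(x, z) : ℝ) ≠ 0 := by
      intro z hz h0
      refine hS' (le_antisymm ?_ measureReal_nonneg)
      have hsub : {ω : BondConfig (Fin n) | ∀ y : Fin n, y ∈ S' ↔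
            (y ∉ ({x} : Finset (Fin n)) ∧ ∃ o ∈ ({x} : Finset (Fin n)), s(o, y) ∈ ω)}
          ⊆ {ω : BondConfig (Fin n) | s(x, z) ∈ ω} := by
        intro ω hω
        obtain ⟨-, o, ho, hoz⟩ := (hω z).1 hz
        rw [Finset.mem_singleton] at ho
        subst ho
        exact hoz
      refine (measureReal_mono hsub (measure_ne_top _ _)).trans (le_of_eq ?_)
      rw [prodBernoulli_real_setOf_mem]
      exact h0
    -- the child block and the new attached set
    set T' : Finset (Fin n) := (T ∪ S') \ S with hT'
    have hblock : (S ∪ T).erase x ∪ S' = S.erase x ∪ T' := by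
      ext z
      simp only [Finset.mem_union, Finset.mem_erase, Finset.mem_sdiff, hT']
      constructor
      · rintro (⟨hzx, hzS | hzT⟩ | hzS')
        · exact Or.inl ⟨hzx, hzS⟩
        · exact Or.inr ⟨Or.inl hzT, Finset.disjoint_right.1 hST hzT⟩
        · by_cases hzS : z ∈ S
          · exact Or.inl ⟨fun h => hxS' (h ▸ hzS'), hzS⟩
          · exact Or.inr ⟨Or.inr hzS', hzS⟩
      · rintro (⟨hzx, hzS⟩ | ⟨hzT | hzS', hzS⟩)
        · exact Or.inl ⟨hzx, Or.inl hzS⟩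
        · exact Or.inl ⟨fun h => hxT (h ▸ hzT), Or.inr hzT⟩
        · exact Or.inr hzS'
    rw [hblock]
    refine ih (fun e : Sym2 (Fin n) => if ∃ y ∈ ({x} : Finset (Fin n)), y ∈ e then (0 : unitInterval) else u e) R A
      (S.erase x) T' b a₀ (fun W => sel (insert x W)) ?_ hb ha₀ ?_ ?_ (fun W => hsel _) ?_ hmin ?_ ?_
    · rw [Finset.card_erase_of_mem hx, hcard, Nat.add_sub_cancel]
    · exact Finset.disjoint_of_subset_left (Finset.erase_subset x S) hSA
    · exact Finset.disjoint_left.2 fun z hz hz' => (Finset.mem_sdiff.1 hz').2 (Finset.mem_of_mem_erase hz)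
    · -- the deleted graph of the child is the same `R`
      intro e
      rw [hR e]
      by_cases h1 : ∃ y ∈ S.erase x, y ∈ e
      · obtain ⟨y, hy, hye⟩ := h1
        rw [if_pos ⟨y, Finset.mem_of_mem_erase hy, hye⟩, if_pos ⟨y, hy, hye⟩]
      rw [if_neg h1]
      by_cases h2 : x ∈ e
      · rw [if_pos ⟨x, hx, h2⟩, if_pos ⟨x, Finset.mem_singleton_self x, h2⟩]
      have h3 : ¬ ∃ y ∈ S, y ∈ e := by
        rintro ⟨y, hy, hye⟩
        by_cases hyx : y = x
        · exact h2 (hyx ▸ hye)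
        · exact h1 ⟨y, Finset.mem_erase.2 ⟨hyx, hy⟩, hye⟩
      have h4 : ¬ ∃ y ∈ ({x} : Finset (Fin n)), y ∈ e := by
        rintro ⟨y, hy, hye⟩
        rw [Finset.mem_singleton] at hy
        exact h2 (hy ▸ hye)
      rw [if_neg h3, if_neg h4]
    · -- the attached vertices are `R`-reliable
      intro z hz
      rcases Finset.mem_sdiff.1 hz with ⟨hzTS', hzS⟩
      rcases Finset.mem_union.1 hzTS' with hzT | hzS'
      · exact hT z hzT
      · exact hnbr x hx z hzS (hS'w z hzS')
    · -- the outside neighbours of the remaining block vertices are `R`-reliable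
      intro s hs z hz hw
      have hsx : s ≠ x := (Finset.mem_erase.1 hs).1
      have hzx : z ≠ x := by
        rintro rfl
        refine hw ?_
        rw [if_pos ⟨z, Finset.mem_singleton_self z, Sym2.mem_mk_right s z⟩]
        rfl
      have hzS : z ∉ S := fun h => hz (Finset.mem_erase.2 ⟨hzx, h⟩)
      refine hnbr s (Finset.mem_of_mem_erase hs) z hzS fun h0 => hw ?_
      have h4 : ¬ ∃ y ∈ ({x} : Finset (Fin n)), y ∈ s(s, z) := by
        rintro ⟨y, hy, hye⟩
        rw [Finset.mem_singleton] at hy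
        subst hy
        rcases Sym2.mem_iff.1 hye with h | h
        · exact hsx h.symm
        · exact hzx h.symm
      rw [if_neg h4]
      exact h0

/-- **The deletion-minimiser leaf (Kozma–Nitzan's Theorem 4 at the glued block).**  If the block `S` misses `A`, the designated relay
`a₀ ∈ A` minimises `μ_R(· ↔ b)` over `A` in the deleted graph `R = u − S` (all pairs meeting `S` killed), and every vertex outside `S`
joined to `S` by a positive-weight pair is at least as `R`-reliable as `a₀`, then block goodness `BG(u, A, S, b, a₀, sel)` holds for
every selection. [cite: KozmaNitzan2024, §3.2 (Thm 4 p. 12, Lemma 5 p. 13, proof of Thm 5 p. 14)] -/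
theorem blockGood_leaf_delMin (u : Sym2 (Fin n) → unitInterval) (A S : Finset (Fin n)) (b a₀ : Fin n)
    (sel : Finset (Fin n) → Fin n) (hb : b ∈ A) (ha₀ : a₀ ∈ A) (hSA : Disjoint S A) (hsel : ∀ W, sel W ∈ A)
    (hmin : ∀ a ∈ A,
      (prodBernoulli (fun e : Sym2 (Fin n) => if ∃ y ∈ S, y ∈ e then (0 : unitInterval) else u e)).real (openConn a₀ b) ≤
        (prodBernoulli (fun e : Sym2 (Fin n) => if ∃ y ∈ S, y ∈ e then (0 : unitInterval) else u e)).real (openConn a b))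
    (hnbr : ∀ s ∈ S, ∀ z : Fin n, z ∉ S → (u s(s, z) : ℝ) ≠ 0 →
      (prodBernoulli (fun e : Sym2 (Fin n) => if ∃ y ∈ S, y ∈ e then (0 : unitInterval) else u e)).real (openConn a₀ b) ≤
        (prodBernoulli (fun e : Sym2 (Fin n) => if ∃ y ∈ S, y ∈ e then (0 : unitInterval) else u e)).real (openConn z b)) :
    (prodBernoulli u).real (openConn a₀ b)
        + (prodBernoulli u).real
            ((openConn a₀ b)ᶜ ∩ (⋃ s ∈ S, openConn a₀ s) ∩ (⋃ s ∈ S, openConn s b))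
      ≤ (prodBernoulli u).real (⋃ s ∈ S, openConn s b)
        + ∑ W ∈ (Finset.univ : Finset (Finset (Fin n))).filter (fun W => Disjoint W A),
            (prodBernoulli u).real {ω : BondConfig (Fin n) | ∀ z : Fin n, (z ∈ W ↔ ω ∈ ⋃ s ∈ S, openConn s z)}
              * (prodBernoulli u).real (openConnIn ((W : Set (Fin n))ᶜ) (sel W) b) := by
  have h := blockGood_delMin_aux S.card u (fun e : Sym2 (Fin n) => if ∃ y ∈ S, y ∈ e then (0 : unitInterval) else u e) A S ∅
    b a₀ sel rfl hb ha₀ hSA (Finset.disjoint_empty_right S) hsel (fun _ => rfl) hmin (by simp) hnbr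
  rwa [Finset.union_empty] at h

end BlockGoodDelMin

open Literature.Probability.LatticeModels Literature.Probability.Percolation in
/-- Registered helper stub `stub_blockGoodLeafDelMin_xb` (invested seat xfam-b): the deletion-minimiser leaf of the peeling certificate
— block goodness whenever the designated relay is a minimiser of the DELETED graph `u − S` and the block's outside neighbours are
reliable there (= `blockGood_leaf_delMin`). [cite: KozmaNitzan2024, §3.2 (Thm 4 p. 12, Lemma 5 p. 13)] -/
theorem stub_blockGoodLeafDelMin_xb : ∀ (n : ℕ) (u : Sym2 (Fin n) → unitInterval) (A S : Finset (Fin n)) (b a₀ : Fin n) (sel : Finset (Fin n) → Fin n), b ∈ A → a₀ ∈ A → Disjoint S A → (∀ W, sel W ∈ A) → (∀ a ∈ A, (prodBernoulli (fun e : Sym2 (Fin n) => if ∃ y ∈ S, y ∈ e then (0 : unitInterval) else u e)).real (openConn a₀ b) ≤ (prodBernoulli (fun e : Sym2 (Fin n) => if ∃ y ∈ S, y ∈ e then (0 : unitInterval) else u e)).real (openConn a b)) → (∀ s ∈ S, ∀ z : Fin n, z ∉ S → (u s(s, z) : ℝ) ≠ 0 → (prodBernoulli (fun e : Sym2 (Fin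 n) => if ∃ y ∈ S, y ∈ e then (0 : unitInterval) else u e)).real (openConn a₀ b) ≤ (prodBernoulli (fun e : Sym2 (Fin n) => if ∃ y ∈ S, y ∈ e then (0 : unitInterval) else u e)).real (openConn z b)) → (prodBernoulli u).real (openConn a₀ b) + (prodBernoulli u).real ((openConn a₀ b)ᶜ ∩ (⋃ s ∈ S, openConn a₀ s) ∩ (⋃ s ∈ S, openConn s b)) ≤ (prodBernoulli u).real (⋃ s ∈ S, openConn s b) + ∑ W ∈ (Finset.univ : Finset (Finset (Fin n))).filter (fun W => Disjoint W A), (prodBernoulli u).real {ω : BondConfig (Fin n) | ∀ z : Fin n, (z ∈ W ↔ ω ∈ ⋃ s ∈ S, openConn s z)} * (prodBernoulli u).real (openConnIn ((W : Set (Fin n))ᶜ) (sel W) b) :=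
  fun _ u A S b a₀ sel hb ha₀ hSA hsel hmin hnbr => blockGood_leaf_delMin u A S b a₀ sel hb ha₀ hSA hsel hmin hnbr

end

end Summit.CriticalPhenomena.PercolationContinuityZ3.Theorems
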